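import Mathlib
import HarnessLib
import Summits.Langlands.Langlands.Theorems.SplitPrimeDescentLadder
import Summits.Langlands.Langlands.Theorems.SplitPrimeDescentLadderResidual
import Literature.NumberTheory.Automorphic.ReciprocityGLnPatchingFamily
import Literature.NumberTheory.Automorphic.ReciprocityGLnPatchingGalois
import Literature.NumberTheory.GaloisRepresentations.SGeneralQuadraticFamily
import Summits.Langlands.Langlands.Theorems.SplitPrimeDescentLadderTwistModel
import Summits.Langlands.Langlands.Theorems.ParityBlindBianchiIcosahedralQuadraticDescentFields

/-!
# D∞' `CofinalResidualDoor` — stub T1 `stub_fieldSupply` PROVED (lens-1 g35)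

For every finite place `p` of `ℚ` (over the rational prime `p₀`) the imaginary quadratic field
`M = ℚ(√-D)`, `D = 24·p₀ - 1` (the tree's `sqrtNegField ℚ D = QuadraticAlgebra ℚ (-D) 0`), satisfies every
FIELD clause of D∞/D∞': CM (`PatchingFamily.isCMField_sqrtNegField`), Galois and cyclic of squarefree degree `2`
(the private window clause is vacuous in degree `2`: its only prime divisor is `ℓ = 2`), `p` split and `3` split
(`8·p₀ ∣ D + 1` and `8·3 ∣ D + 1`; decomposition law `QuadraticFamily.ncard_primesOver_sqrtNegField_eq_two` +
`PatchingFamily.ramificationIdxIn_eq_one_of_ncard_eq_finrank`, transported to the `𝓞 ℚ`-relative residue degree /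
ramification index of the clause by Mathlib's `Ideal.inertiaDegIn_eq_inertiaDeg` / `ramificationIdxIn_eq_ramificationIdx`),
`ω² + D = 0` with `D ≡ 2 (mod 3)`, and no primitive cube root of unity (`(2z+1)² = -3` would make `3·D` a rational
square, `QuadraticFamily.isSquare_mul_of_sq_eq`, impossible for `3 ∤ D`).  Statement and the clause definitions
`FieldClauses` / `ThreeSplit` are VERBATIM those of the D∞' afterbirth (`stub_fieldSupply`).  0 sorry.
-/

set_option linter.dupNamespace false

noncomputable section

open scoped NumberField
open NumberField IsDedekindDomain Polynomial
open Literature.NumberTheory.GaloisRepresentations.QuadraticFamily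

namespace Summit.Langlands.Langlands.Theorems.SplitPrimeDescentLadder.V3Birth.CofinalResidualDoor

/-! ### Proof of T1 -/

section FieldSupplyProof

variable {D : ℕ} [Fact (¬ IsSquare (-(D : ℚ)))]

/-- **Complete splitting in `ℚ(√-D)`** of the place `v ∋ q` of `ℚ`, `8q ∣ D + 1`, in the `𝓞 ℚ`-relative currency of
the clauses: every place `w` of `ℚ(√-D)` above `v` has residue degree `1` and ramification index `1`. [folklore] -/
theorem inertiaDeg_ramificationIdx_eq_one_of_dvd {q : ℕ} (hq : q.Prime) (v : HeightOneSpectrum (𝓞 ℚ))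
    (hv : ((q : ℕ) : 𝓞 ℚ) ∈ v.asIdeal) (hD : 8 * q ∣ D + 1)
    (w : HeightOneSpectrum (𝓞 (sqrtNegField ℚ D))) (hw : w.asIdeal.under (𝓞 ℚ) = v.asIdeal) :
    w.asIdeal.inertiaDeg (𝓞 ℚ) = 1 ∧ w.asIdeal.ramificationIdx (𝓞 ℚ) = 1 := by
  haveI : Algebra.IsQuadraticExtension ℚ (sqrtNegField ℚ D) := ⟨finrank_sqrtNegField⟩
  haveI : IsGalois ℚ (sqrtNegField ℚ D) := inferInstance
  haveI := w.isPrime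
  have h2 : (v.asIdeal.primesOver (𝓞 (sqrtNegField ℚ D))).ncard =
      Module.finrank ℚ (sqrtNegField ℚ D) := by
    rw [finrank_sqrtNegField]
    exact ncard_primesOver_sqrtNegField_eq_two v hq hv hD
  obtain ⟨he, hf⟩ :=
    Literature.NumberTheory.Automorphic.PatchingFamily.ramificationIdxIn_eq_one_of_ncard_eq_finrank v h2
  haveI : w.asIdeal.LiesOver v.asIdeal := ⟨hw.symm⟩
  constructor
  · rw [← Ideal.inertiaDegIn_eq_inertiaDeg v.asIdeal w.asIdeal
      (sqrtNegField ℚ D ≃ₐ[ℚ] sqrtNegField ℚ D)]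
    exact hf
  · rw [← Ideal.ramificationIdxIn_eq_ramificationIdx v.asIdeal w.asIdeal
      (sqrtNegField ℚ D ≃ₐ[ℚ] sqrtNegField ℚ D)]
    exact he

/-- **No primitive cube root of unity in `ℚ(√-D)` for `D ≡ 2 (mod 3)`**: `(2z+1)² = -3` would give
`√(3D) ∈ ℚ` (`isSquare_mul_of_sq_eq`), i.e. `3D = m²`, forcing `3 ∣ D`. [folklore] -/
theorem sq_add_self_add_one_ne_zero (hD3 : D % 3 = 2) (z : sqrtNegField ℚ D) : z ^ 2 + z + 1 ≠ 0 := by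
  intro hz
  haveI : Fact (¬ IsSquare (-((3 : ℕ) : ℚ))) := ⟨Summit.Langlands.Langlands.Theorems.IcosahedralQuadraticDescent.not_isSquare_neg_natCast (by norm_num)⟩
  have hs : (2 * z + 1) ^ 2 = algebraMap ℚ (sqrtNegField ℚ D) (-((3 : ℕ) : ℚ)) := by
    rw [map_neg, map_natCast]
    push_cast
    linear_combination 4 * hz
  have hsq : IsSquare ((D * 3 : ℕ) : ℚ) := isSquare_mul_of_sq_eq hs
  rw [Rat.isSquare_natCast_iff] at hsq
  obtain ⟨m, hm⟩ := hsq
  have h3 : 3 ∣ m * m := ⟨D, by rw [← hm]; ring⟩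
  have h3m : 3 ∣ m := (Nat.prime_three.dvd_mul.mp h3).elim id id
  obtain ⟨k, rfl⟩ := h3m
  have hDk : D * 3 = 3 * (k * k) * 3 := by rw [hm]; ring
  have hD' : D = 3 * (k * k) := Nat.eq_of_mul_eq_mul_right (by norm_num) hDk
  have : D % 3 = 0 := by rw [hD', Nat.mul_mod_right]
  omega

end FieldSupplyProof

/-- **T1 `stub_fieldSupply` — PROVED.**  For every finite place `p` of `ℚ`, the imaginary quadratic field
`ℚ(√-(24 p₀ - 1))` (`p₀` the rational prime under `p`) satisfies the field clauses of D∞' and has `3` split.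
[folklore: decomposition law in quadratic fields, Marcus *Number Fields* Ch. 3 Thm. 25; tree `sqrtNegField`] -/
theorem fieldSupply_holds :
    ∀ p : IsDedekindDomain.HeightOneSpectrum (NumberField.RingOfIntegers ℚ), ∃ (M : Type) (_ : Field M) (_ : NumberField M), FieldClauses p M ∧ ThreeSplit M := by
  intro p
  obtain ⟨p₀, hp₀, hp₀v⟩ := exists_prime_natCast_mem p
  have hp2 : 2 ≤ p₀ := hp₀.two_le
  obtain ⟨D, hD1⟩ : ∃ D : ℕ, D + 1 = 24 * p₀ := ⟨24 * p₀ - 1, by omega⟩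
  have hDpos : 0 < D := by omega
  have hD3 : D % 3 = 2 := by omega
  haveI : Fact (¬ IsSquare (-(D : ℚ))) := ⟨Summit.Langlands.Langlands.Theorems.IcosahedralQuadraticDescent.not_isSquare_neg_natCast hDpos⟩
  haveI : Algebra.IsQuadraticExtension ℚ (sqrtNegField ℚ D) := ⟨finrank_sqrtNegField⟩
  haveI hG : IsGalois ℚ (sqrtNegField ℚ D) := inferInstance
  refine ⟨sqrtNegField ℚ D, inferInstance, inferInstance, ⟨?_, hG, ?_, ?_, ?_, ?_, ?_, ?_⟩, ?_⟩
  · exact Literature.NumberTheory.Automorphic.PatchingFamily.isCMField_sqrtNegField (K := ℚ) (D := D)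
      (Or.inl inferInstance) hDpos.ne'
  · haveI : Fact (Nat.Prime 2) := ⟨Nat.prime_two⟩
    have hcard : Nat.card (sqrtNegField ℚ D ≃ₐ[ℚ] sqrtNegField ℚ D) = 2 := by
      rw [IsGalois.card_aut_eq_finrank, finrank_sqrtNegField]
    exact isCyclic_of_prime_card hcard
  · rw [finrank_sqrtNegField]
    exact Nat.prime_two.prime.squarefree
  · intro ℓ hℓ hdvd
    rw [finrank_sqrtNegField] at hdvd
    exact Or.inl ((Nat.prime_dvd_prime_iff_eq hℓ Nat.prime_two).mp hdvd)
  · intro w hw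
    exact inertiaDeg_ramificationIdx_eq_one_of_dvd hp₀ p hp₀v (by rw [hD1]; exact ⟨3, by ring⟩) w hw
  · refine ⟨D, QuadraticAlgebra.omega, hD3, ?_⟩
    rw [omega_sq, map_neg, map_natCast, neg_add_cancel]
  · exact sq_add_self_add_one_ne_zero hD3
  · intro w h3
    haveI := w.isPrime
    have hmem : (3 : 𝓞 ℚ) ∈ w.asIdeal.under (𝓞 ℚ) := by
      rw [Ideal.under_def, Ideal.mem_comap, map_ofNat]
      exact h3
    have hne : w.asIdeal.under (𝓞 ℚ) ≠ ⊥ := by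
      intro h
      rw [h, Ideal.mem_bot] at hmem
      exact (by exact_mod_cast (by norm_num : (3 : ℕ) ≠ 0) : (3 : NumberField.RingOfIntegers ℚ) ≠ 0) hmem
    let v : HeightOneSpectrum (𝓞 ℚ) := ⟨w.asIdeal.under (𝓞 ℚ), inferInstance, hne⟩
    have hv : ((3 : ℕ) : 𝓞 ℚ) ∈ v.asIdeal := by
      rw [Nat.cast_ofNat]
      exact hmem
    exact inertiaDeg_ramificationIdx_eq_one_of_dvd Nat.prime_three v hv (by rw [hD1]; exact ⟨p₀, by ring⟩) w rfl

end Summit.Langlands.Langlands.Theorems.SplitPrimeDescentLadder.V3Birth.CofinalResidualDoor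

end
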